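import Literature.NumberTheory.GaloisRepresentations.GaloisCohomologyLayerInflationTwo
import Literature.NumberTheory.GaloisRepresentations.ContinuousH1DiscreteGroup
import Literature.NumberTheory.GaloisRepresentations.GaloisCohomologyInfResProofs
import Literature.NumberTheory.GaloisRepresentations.GaloisCohomologyProofs
import Literature.Algebra.Homology.GroupCohomologyCupProductLowDegree
import HarnessLib

/-!
# Inflation from a finite Galois layer commutes with cup products in bidegree `(1, 1)`:
# `inf([f] ∪ [g]) = inf[f] ∪ inf[g]` — the finite-group engine's cup product (Brown V §3) meets the
# tree's continuous cup product on `galoisCohomology` (Serre, *Galois Cohomology* I §2.2, §2.6;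
# Neukirch–Schmidt–Wingberg (1.5.3))

Topic `NumberTheory/GaloisRepresentations`; namespace `Literature.NumberTheory.GaloisRepresentations`.
Definitions with bodies and theorems; no named fact, no instance, no notation.  Sequel to
`GaloisCohomologyLayerInflationTwo` (door-c6 g9: `absGaloisLayerRep ρ L = M^{Γ_L}` as a `Rep ℤ (Γ_K ⧸ Γ_L)`,
`infTwo ρ L : H²(Γ_K ⧸ Γ_L, M^{Γ_L}) →+ H²(K, M)` with the cocycle formula `infTwo_H2π`).

For a field `K : Type`, a finite normal `L ⊆ K̄` (`Γ_L = absGaloisFixingSubgroup L`, open) and discrete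
`Γ_K`-modules `M`, `N`, `Z`:

* §1 **degree one**: `absGaloisLayerH1Equiv ρ L : H¹(Γ_K ⧸ Γ_L, M^{Γ_L}) ≃ₗ[ℤ] H¹_cont(Γ_K ⧸ Γ_L, M^{Γ_L})`
  (Mathlib `groupCohomology` of the finite discrete quotient vs the tree's `continuousCohomology`,
  `H1DiscreteEquiv`), **`infOneLayer ρ L : groupCohomology (absGaloisLayerRep ρ L) 1 →+ galoisCohomology ρ 1`**
  and its cocycle formula **`infOneLayer_H1π`**: `inf [f] = [σ ↦ f(σ̄)]` (`inflateOneCocycle`,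
  `inflateOneCocycle_apply`); `infOneLayer_injective` (inflation–restriction, tree
  `inf_one_injective_holds`); `exists_infOneLayer_eq` — **`H¹(K, M) = ⋃_E inf H¹(Gal(E/K), M^{Γ_E})`**
  (Serre I §2.2 Cor. 1 in degree one, tree `exists_inf_eq_one_holds`).
* §2 **the cup product**: for the engine's cup product
  `cupProductRep : H¹(G, M') × H¹(G, N') → H²(G, M' ⊗ N')` (`Literature.Algebra.Homology`, Brown V §3,
  Alexander–Whitney `(f ∪ g)(a, b) = f(a) ⊗ a·g(b)`) on the layer modules `M' = M^{Γ_L}`, `N' = N^{Γ_L}`,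
  any `Rep`-morphism `β : M' ⊗ N' ⟶ Z' = Z^{Γ_L}` lying over a continuous `Γ_K`-pairing
  `φ : M × N → Z` (`ContPairing`; hypothesis `hβ : β(w ⊗ w') = φ(w, w')`), and classes `x ∈ H¹(G, M')`,
  `y ∈ H¹(G, N')`:
  **`infTwo_map_cupProductRep`**: `infTwo (β_* (x ∪ y)) = φ.cupProduct (infOneLayer x) (infOneLayer y)`
  in `H²(K, Z)` — both sides are the class of the continuous 2-cocycle `(σ, τ) ↦ φ(f(σ̄), σ·g(τ̄))`
  (`infTwo_H2π`, engine `cupProductRep_H1π_H1π` + `cupOneOne_apply`, Mathlib `H2π_comp_map`, tree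
  `cupProduct_oneCocycleClass_eq_twoCocycleClass` + `cupCocycle_apply_eq_smul`); the canonical
  `β = layerPairingHom φ` (`layerBilin`, `layerPairingHom_tmul`) and the hypothesis-free form
  **`infTwo_map_layerPairingHom_cupProductRep`**.

This is the bridge by which the class-module engine's finite-level duality pairings in bidegree
`(1, 1)` (Tate–Nakayama with lattice coefficients, `IsClassModule.tateNakayamaIso`; the cup product
`H¹(G, Hom(A, C)) × H¹(G, A) → H²(G, C)`) are compared with the tree's continuous pairings
(`localTatePairingZMod = inv ∘ cupProduct`, `LocalInvariants`, the Poitou–Tate maps `γ¹`) — Route A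
of the bsd-schneider cell (crux `AnticycControlAdditiveK`).  HONEST FRAMING: homological algebra
only; no arithmetic statement is proved here.

## References
* J.-P. Serre, *Galois Cohomology* (1997), Ch. I §2.2 Prop. 8 (`H^q(G, A) = lim→ H^q(G/U, A^U)`),
  §2.6 (compatibility of inflation with cup products). [SerreGaloisCohomology1997]
* J. Neukirch, A. Schmidt, K. Wingberg, *Cohomology of Number Fields* (2008), Prop. (1.5.3)
  (`inf(α ∪ β) = inf α ∪ inf β`). [NeukirchSchmidtWingberg2008]
* K. S. Brown, *Cohomology of Groups*, GTM 87 (1982), V §3 (Alexander–Whitney formula).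
  [Brown1982CohomologyGroups]
-/

noncomputable section

open CategoryTheory groupCohomology Field Function MonoidalCategory
open scoped TensorProduct

namespace Literature.NumberTheory.GaloisRepresentations

open LocalWeilDatum Literature.Algebra.Homology

-- Cup products on `Γ_K` need `LocallyCompactSpace Γ_K`; the tree's `absoluteGaloisGroup_compactSpace`
-- is the only source (as in `GaloisCohomologyLayerInflationTwo`).  Local to this file.
attribute [local instance] absoluteGaloisGroup_compactSpace

variable (K : Type) [Field K]
variable (L : IntermediateField K (AlgebraicClosure K)) [FiniteDimensional K L] [Normal K L]

/-! ## §1. Degree one: `infOneLayer` and its cocycle formula -/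

section DegreeOne

variable {M : Type} [AddCommGroup M] [TopologicalSpace M] [DiscreteTopology M] (ρ : DiscreteGaloisModule K M)

/-- **`H¹(Γ_K ⧸ Γ_L, M^{Γ_L})` (Mathlib `groupCohomology`) `≃ H¹_cont(Γ_K ⧸ Γ_L, M^{Γ_L})`** (the quotient is
finite discrete; `H1DiscreteEquiv`). [cite: SerreGaloisCohomology1997, I §2.3] -/
def absGaloisLayerH1Equiv :
    groupCohomology (absGaloisLayerRep K L ρ) 1 ≃ₗ[ℤ]
      (continuousCohomology 1 (ρ.quotientInvariants (absGaloisFixingSubgroup L)).toTopRep :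
        TopModuleCat ℤ) :=
  haveI := discreteTopology_quotient_absGaloisFixingSubgroup K L
  H1DiscreteEquiv (ρ.quotientInvariants (absGaloisFixingSubgroup L)).toRepresentation
    (ρ.quotientInvariants (absGaloisFixingSubgroup L)).toContRepresentation (fun _ _ => rfl)

/-- **Inflation `inf : H¹(Γ_K ⧸ Γ_L, M^{Γ_L}) → H¹(K, M)`** from Mathlib's finite-group `H¹` of the layer
(the composite of `absGaloisLayerH1Equiv` with the tree's `galoisCohomology.inf`).
[cite: SerreGaloisCohomology1997, I §2.2 Prop. 8][cite: NeukirchSchmidtWingberg2008, (1.5.1)] -/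
def infOneLayer : groupCohomology (absGaloisLayerRep K L ρ) 1 →+ galoisCohomology ρ 1 :=
  (galoisCohomology.inf ρ (absGaloisFixingSubgroup L) 1).comp (absGaloisLayerH1Equiv K L ρ).toAddMonoidHom

/-- The inflated crossed homomorphism `σ ↦ f(σ̄) ∈ M` of a `1`-cocycle `f` of the layer, as a continuous
`1`-cocycle of `Γ_K` (locally constant). [cite: SerreGaloisCohomology1997, I §2.2] -/
def inflateOneCocycle (f : cocycles₁ (absGaloisLayerRep K L ρ)) : contOneCocycles ρ.toTopRep :=
  haveI := discreteTopology_quotient_absGaloisFixingSubgroup K L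
  contOneCocycles.pullback (ContinuousMonoidHom.quotientMk (absGaloisFixingSubgroup L))
    (X := (ρ.quotientInvariants (absGaloisFixingSubgroup L)).toTopRep) (Y := ρ.toTopRep)
    (TopRep.ofHom ⟨Submodule.subtypeL _, fun _ => rfl⟩)
    (cocycles₁ToContOneCocycles (ρ.quotientInvariants (absGaloisFixingSubgroup L)).toRepresentation
      (ρ.quotientInvariants (absGaloisFixingSubgroup L)).toContRepresentation (fun _ _ => rfl) f)

/-- Unfolding: `inflateOneCocycle f σ = f(σ̄)` in `M`. [cite: SerreGaloisCohomology1997, I §2.2] -/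
@[simp] theorem inflateOneCocycle_apply (f : cocycles₁ (absGaloisLayerRep K L ρ)) (σ : absoluteGaloisGroup K) :
    (inflateOneCocycle K L ρ f).1 σ =
      Subtype.val ((f : (absoluteGaloisGroup K ⧸ absGaloisFixingSubgroup L) → _)
        (σ : absoluteGaloisGroup K ⧸ absGaloisFixingSubgroup L)) := rfl

/-- **The cocycle formula for inflation in degree one: `inf [f] = [σ ↦ f(σ̄)]`.**
[cite: SerreGaloisCohomology1997, I §2.2 Prop. 8][cite: NeukirchSchmidtWingberg2008, (1.5.1)] -/
theorem infOneLayer_H1π (f : cocycles₁ (absGaloisLayerRep K L ρ)) :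
    infOneLayer K L ρ (H1π (absGaloisLayerRep K L ρ) f) = oneCocycleClass ρ.toTopRep (inflateOneCocycle K L ρ f) := by
  haveI := discreteTopology_quotient_absGaloisFixingSubgroup K L
  change galoisCohomology.inf ρ (absGaloisFixingSubgroup L) 1
    (H1DiscreteEquiv (ρ.quotientInvariants (absGaloisFixingSubgroup L)).toRepresentation
      (ρ.quotientInvariants (absGaloisFixingSubgroup L)).toContRepresentation (fun _ _ => rfl)
      (H1π (absGaloisLayerRep K L ρ) f)) = _
  rw [H1DiscreteEquiv_H1π]
  exact map_oneCocycleClass (ContinuousMonoidHom.quotientMk (absGaloisFixingSubgroup L))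
    (X := (ρ.quotientInvariants (absGaloisFixingSubgroup L)).toTopRep) (Y := ρ.toTopRep)
    (TopRep.ofHom ⟨Submodule.subtypeL _, fun _ => rfl⟩) _


/-- **Inflation in degree one is injective** (first map of the inflation–restriction sequence; tree
`galoisCohomology.inf_one_injective_holds`). [cite: SerreGaloisCohomology1997, I §2.6 (b)]
[cite: NeukirchSchmidtWingberg2008, (1.6.7)] -/
theorem infOneLayer_injective : Injective (infOneLayer K L ρ) := by
  haveI : IsClosed ((absGaloisFixingSubgroup L : Subgroup (absoluteGaloisGroup K)) :
      Set (absoluteGaloisGroup K)) :=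
    (absGaloisFixingSubgroup L).isClosed_of_isOpen (isOpen_absGaloisFixingSubgroup K L)
  intro x y hxy
  apply (absGaloisLayerH1Equiv K L ρ).injective
  exact galoisCohomology.inf_one_injective_holds K M ρ (absGaloisFixingSubgroup L) ‹_› hxy

omit [FiniteDimensional K L] [Normal K L] in
/-- **`H¹(K, M)` is the union of the inflations from its finite Galois layers** (Serre I §2.2 Cor. 1 to
Prop. 8 in degree `1`; tree `galoisCohomology.exists_inf_eq_one_holds`): every class of `H¹(K, M)` is
`infOneLayer` of a class of Mathlib's `H¹(Gal(E/K), M^{Γ_E})` for some finite Galois `E ⊆ K̄`.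
[cite: SerreGaloisCohomology1997, I §2.2 Cor. 1 to Prop. 8][cite: NeukirchSchmidtWingberg2008, (1.2.5)] -/
theorem exists_infOneLayer_eq (x : galoisCohomology ρ 1) :
    ∃ (E : IntermediateField K (AlgebraicClosure K)) (_ : FiniteDimensional K E) (_ : IsGalois K E)
      (y : groupCohomology (absGaloisLayerRep K E ρ) 1), infOneLayer K E ρ y = x := by
  obtain ⟨E, hE, hE', y, hy⟩ := galoisCohomology.exists_inf_eq_one_holds K M ρ x
  haveI := hE
  haveI := hE'
  refine ⟨E, hE, hE', (absGaloisLayerH1Equiv K E ρ).symm y, ?_⟩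
  change galoisCohomology.inf ρ (absGaloisFixingSubgroup E) 1
    ((absGaloisLayerH1Equiv K E ρ) ((absGaloisLayerH1Equiv K E ρ).symm y)) = x
  rw [LinearEquiv.apply_symm_apply]
  exact hy

end DegreeOne

/-! ## §2. `inf([f] ∪ [g]) = inf[f] ∪ inf[g]` -/

section Cup

variable {M N Z : Type} [AddCommGroup M] [TopologicalSpace M] [DiscreteTopology M]
  [AddCommGroup N] [TopologicalSpace N] [DiscreteTopology N]
  [AddCommGroup Z] [TopologicalSpace Z] [DiscreteTopology Z]
variable (ρM : DiscreteGaloisModule K M) (ρN : DiscreteGaloisModule K N) (ρZ : DiscreteGaloisModule K Z)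

/-- The layer pairing `M^{Γ_L} × N^{Γ_L} → Z^{Γ_L}` of a continuous `Γ_K`-pairing `φ : M × N → Z`, as a
`ℤ`-bilinear map (values are `Γ_L`-invariant by the equivariance of `φ`).
[cite: NeukirchSchmidtWingberg2008, I §4 (pairings `A × B → C`)] -/
def layerBilin (φ : ContPairing ρM.toTopRep ρN.toTopRep ρZ.toTopRep) :
    Representation.invariants (ρM.toRepresentation.comp (absGaloisFixingSubgroup L).subtype) →ₗ[ℤ]
      Representation.invariants (ρN.toRepresentation.comp (absGaloisFixingSubgroup L).subtype) →ₗ[ℤ]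
        Representation.invariants (ρZ.toRepresentation.comp (absGaloisFixingSubgroup L).subtype) :=
  LinearMap.mk₂ ℤ
    (fun w w' => ⟨φ.toLin (w : M) (w' : N), fun s => by
      have h := φ.toLin_smul (s : absoluteGaloisGroup K) (w : M) (w' : N)
      change φ.toLin (ρM s (w : M)) (ρN s (w' : N)) = ρZ s (φ.toLin (w : M) (w' : N)) at h
      change ρZ s (φ.toLin (w : M) (w' : N)) = φ.toLin (w : M) (w' : N)
      rw [← h]
      exact congrArg₂ (fun a b => φ.toLin a b) (w.2 s) (w'.2 s)⟩)
    (fun w₁ w₂ w' => Subtype.ext (by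
      change φ.toLin ((w₁ : M) + (w₂ : M)) (w' : N) = φ.toLin (w₁ : M) (w' : N) + φ.toLin (w₂ : M) (w' : N)
      rw [map_add, LinearMap.add_apply]))
    (fun c w w' => Subtype.ext (by
      change φ.toLin (c • (w : M)) (w' : N) = c • φ.toLin (w : M) (w' : N)
      rw [map_zsmul, LinearMap.smul_apply]))
    (fun w w₁' w₂' => Subtype.ext (by
      change φ.toLin (w : M) ((w₁' : N) + (w₂' : N)) = φ.toLin (w : M) (w₁' : N) + φ.toLin (w : M) (w₂' : N)
      rw [map_add]))
    (fun c w w' => Subtype.ext (by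
      change φ.toLin (w : M) (c • (w' : N)) = c • φ.toLin (w : M) (w' : N)
      rw [map_zsmul]))

omit [FiniteDimensional K L] in
/-- Unfolding `layerBilin`. [cite: NeukirchSchmidtWingberg2008, I §4] -/
@[simp] theorem layerBilin_apply_coe (φ : ContPairing ρM.toTopRep ρN.toTopRep ρZ.toTopRep)
    (w : Representation.invariants (ρM.toRepresentation.comp (absGaloisFixingSubgroup L).subtype))
    (w' : Representation.invariants (ρN.toRepresentation.comp (absGaloisFixingSubgroup L).subtype)) :
    (layerBilin K L ρM ρN ρZ φ w w' : Z) = φ.toLin (w : M) (w' : N) := rfl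

/-- **The layer pairing as a morphism `M^{Γ_L} ⊗ N^{Γ_L} ⟶ Z^{Γ_L}` of `Rep ℤ (Γ_K ⧸ Γ_L)`** (linearised
along Mathlib's tensor product of representations, diagonal action): the coefficient map along which the
engine's cup product `H¹(G, M^{Γ_L}) × H¹(G, N^{Γ_L}) → H²(G, M^{Γ_L} ⊗ N^{Γ_L})` is pushed to
`H²(G, Z^{Γ_L})`. [cite: NeukirchSchmidtWingberg2008, I §4 (pairings `A × B → C` and `∪`)]
[cite: Brown1982CohomologyGroups, V §3] -/
def layerPairingHom (φ : ContPairing ρM.toTopRep ρN.toTopRep ρZ.toTopRep) :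
    absGaloisLayerRep K L ρM ⊗ absGaloisLayerRep K L ρN ⟶ absGaloisLayerRep K L ρZ :=
  Rep.ofHom (LinearMap.intertwiningMap_of_isIntertwiningMap _ _
    (TensorProduct.lift (layerBilin K L ρM ρN ρZ φ)) fun g t => by
      induction g using QuotientGroup.induction_on with
      | H σ =>
      induction t using TensorProduct.induction_on with
      | zero => rw [map_zero, map_zero, map_zero]
      | tmul w w' =>
        rw [Representation.tprod_apply, TensorProduct.map_tmul, TensorProduct.lift.tmul,
          TensorProduct.lift.tmul]
        refine Subtype.ext ?_
        have h := φ.toLin_smul σ (w : M) (w' : N)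
        change φ.toLin (ρM σ (w : M)) (ρN σ (w' : N)) = ρZ σ (φ.toLin (w : M) (w' : N)) at h
        exact h
      | add t₁ t₂ h₁ h₂ => rw [map_add, map_add, h₁, h₂, map_add, map_add])

omit [FiniteDimensional K L] in
/-- **`layerPairingHom` lies over `φ`**: `β(w ⊗ w') = φ(w, w')` in `Z` — the hypothesis `hβ` of
`infTwo_map_cupProductRep` for `β = layerPairingHom φ`. [cite: NeukirchSchmidtWingberg2008, I §4] -/
theorem layerPairingHom_tmul (φ : ContPairing ρM.toTopRep ρN.toTopRep ρZ.toTopRep)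
    (w : Representation.invariants (ρM.toRepresentation.comp (absGaloisFixingSubgroup L).subtype))
    (w' : Representation.invariants (ρN.toRepresentation.comp (absGaloisFixingSubgroup L).subtype)) :
    Subtype.val ((layerPairingHom K L ρM ρN ρZ φ).hom
      (w ⊗ₜ[ℤ] w' : (absGaloisLayerRep K L ρM ⊗ absGaloisLayerRep K L ρN).V)) = φ.toLin (w : M) (w' : N) := by
  change Subtype.val (TensorProduct.lift (layerBilin K L ρM ρN ρZ φ) (w ⊗ₜ[ℤ] w')) = _
  rw [TensorProduct.lift.tmul]
  rfl

/-- **The inflated cup-product cocycle**: for `1`-cocycles `f`, `g` of the layer modules and a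
`Rep`-morphism `β : M^{Γ_L} ⊗ N^{Γ_L} ⟶ Z^{Γ_L}` over a continuous pairing `φ : M × N → Z`, the inflation
of the engine's `2`-cocycle `β ∘ (f ∪ g)`, `(a, b) ↦ β(f(a) ⊗ a·g(b))` (Brown's Alexander–Whitney formula,
`cupOneOne_apply`) IS the tree's cup-product cocycle `(σ, τ) ↦ φ(f(σ̄), σ·g(τ̄))` of the inflated crossed
homomorphisms (`ContPairing.cupCocycle`, `cupCocycle_apply_eq_smul`).
[cite: Brown1982CohomologyGroups, V §3 (Alexander–Whitney formula)][cite: NeukirchSchmidtWingberg2008, (1.5.3)] -/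
theorem inflateTwoCocycle_mapCocycles₂_cupOneOne (φ : ContPairing ρM.toTopRep ρN.toTopRep ρZ.toTopRep)
    (β : absGaloisLayerRep K L ρM ⊗ absGaloisLayerRep K L ρN ⟶ absGaloisLayerRep K L ρZ)
    (hβ : ∀ (w : Representation.invariants (ρM.toRepresentation.comp (absGaloisFixingSubgroup L).subtype))
      (w' : Representation.invariants (ρN.toRepresentation.comp (absGaloisFixingSubgroup L).subtype)),
      Subtype.val (β.hom (w ⊗ₜ[ℤ] w' : (absGaloisLayerRep K L ρM ⊗ absGaloisLayerRep K L ρN).V)) =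
        φ.toLin (w : M) (w' : N))
    (f : cocycles₁ (absGaloisLayerRep K L ρM)) (g : cocycles₁ (absGaloisLayerRep K L ρN)) :
    inflateTwoCocycle K L ρZ
        (mapCocycles₂ (A := absGaloisLayerRep K L ρM ⊗ absGaloisLayerRep K L ρN) (MonoidHom.id _) β
          (cupOneOne (absGaloisLayerRep K L ρM) (absGaloisLayerRep K L ρN) f g)) =
      φ.cupCocycle (inflateOneCocycle K L ρM f) (inflateOneCocycle K L ρN g) := by
  refine Subtype.ext (ContinuousMap.ext fun p => ?_)
  obtain ⟨σ, τ⟩ := p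
  -- left side: `β(f(σ̄) ⊗ σ̄·g(τ̄))`, read in `Z`
  have eL : (inflateTwoCocycle K L ρZ
        (mapCocycles₂ (A := absGaloisLayerRep K L ρM ⊗ absGaloisLayerRep K L ρN) (MonoidHom.id _) β
          (cupOneOne (absGaloisLayerRep K L ρM) (absGaloisLayerRep K L ρN) f g))).1 (σ, τ) =
      φ.toLin (Subtype.val ((f : (absoluteGaloisGroup K ⧸ absGaloisFixingSubgroup L) → _)
          (σ : absoluteGaloisGroup K ⧸ absGaloisFixingSubgroup L)))
        (Subtype.val ((absGaloisLayerRep K L ρN).ρ (σ : absoluteGaloisGroup K ⧸ absGaloisFixingSubgroup L)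
          ((g : (absoluteGaloisGroup K ⧸ absGaloisFixingSubgroup L) → _)
            (τ : absoluteGaloisGroup K ⧸ absGaloisFixingSubgroup L)))) := by
    rw [inflateTwoCocycle_apply, coe_mapCocycles₂]
    change Subtype.val (β.hom (cupOneOne (absGaloisLayerRep K L ρM) (absGaloisLayerRep K L ρN) f g
      ((σ : absoluteGaloisGroup K ⧸ absGaloisFixingSubgroup L),
        (τ : absoluteGaloisGroup K ⧸ absGaloisFixingSubgroup L)))) = _
    rw [cupOneOne_apply, hβ]
  -- right side: `φ(F(σ), σ·G(τ))`
  have eR := φ.cupCocycle_apply_eq_smul (inflateOneCocycle K L ρM f) (inflateOneCocycle K L ρN g) σ τ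
  rw [eL, eR]
  rfl

/-- **Inflation commutes with cup products in bidegree `(1, 1)`.**  Let `φ : M × N → Z` be a continuous
`Γ_K`-pairing of discrete modules (`ContPairing`) and `β : M^{Γ_L} ⊗ N^{Γ_L} ⟶ Z^{Γ_L}` a morphism of
`Rep ℤ (Γ_K ⧸ Γ_L)` lying over it (`hβ : β(w ⊗ w') = φ(w, w')` in `Z`).  Then for `x ∈ H¹(Γ_K ⧸ Γ_L, M^{Γ_L})`,
`y ∈ H¹(Γ_K ⧸ Γ_L, N^{Γ_L})` (Mathlib `groupCohomology`) the engine's cup product `β_*(x ∪ y) ∈ H²(Γ_K ⧸ Γ_L, Z^{Γ_L})`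
(`cupProductRep`, Brown V §3, pushed along `β`) inflates to the tree's continuous cup product of the
inflated classes: `infTwo (β_*(x ∪ y)) = φ.cupProduct (infOneLayer x) (infOneLayer y)` in `H²(K, Z)`.
Both sides are the class of `(σ, τ) ↦ φ(f(σ̄), σ · g(τ̄))`.
[cite: NeukirchSchmidtWingberg2008, (1.5.3)][cite: SerreGaloisCohomology1997, I §2.6]
[cite: Brown1982CohomologyGroups, V §3 (Alexander–Whitney formula)] -/
theorem infTwo_map_cupProductRep (φ : ContPairing ρM.toTopRep ρN.toTopRep ρZ.toTopRep)
    (β : absGaloisLayerRep K L ρM ⊗ absGaloisLayerRep K L ρN ⟶ absGaloisLayerRep K L ρZ)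
    (hβ : ∀ (w : Representation.invariants (ρM.toRepresentation.comp (absGaloisFixingSubgroup L).subtype))
      (w' : Representation.invariants (ρN.toRepresentation.comp (absGaloisFixingSubgroup L).subtype)),
      Subtype.val (β.hom (w ⊗ₜ[ℤ] w' : (absGaloisLayerRep K L ρM ⊗ absGaloisLayerRep K L ρN).V)) =
        φ.toLin (w : M) (w' : N))
    (x : groupCohomology (absGaloisLayerRep K L ρM) 1) (y : groupCohomology (absGaloisLayerRep K L ρN) 1) :
    infTwo K L ρZ (map (A := absGaloisLayerRep K L ρM ⊗ absGaloisLayerRep K L ρN) (MonoidHom.id _) β 2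
        (cupProductRep (absGaloisLayerRep K L ρM) (absGaloisLayerRep K L ρN) (rfl : 1 + 1 = 2) x y)) =
      φ.cupProduct (infOneLayer K L ρM x) (infOneLayer K L ρN y) := by
  induction x using H1_induction_on with
  | h f =>
  induction y using H1_induction_on with
  | h g =>
  have h1 : cupProductRep (absGaloisLayerRep K L ρM) (absGaloisLayerRep K L ρN) (rfl : 1 + 1 = 2)
      (H1π (absGaloisLayerRep K L ρM) f) (H1π (absGaloisLayerRep K L ρN) g) =
      H2π (absGaloisLayerRep K L ρM ⊗ absGaloisLayerRep K L ρN)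
        (cupOneOne (absGaloisLayerRep K L ρM) (absGaloisLayerRep K L ρN) f g) :=
    cupProductRep_H1π_H1π _ _ f g
  have h2 : map (A := absGaloisLayerRep K L ρM ⊗ absGaloisLayerRep K L ρN) (MonoidHom.id _) β 2
        (H2π (absGaloisLayerRep K L ρM ⊗ absGaloisLayerRep K L ρN)
          (cupOneOne (absGaloisLayerRep K L ρM) (absGaloisLayerRep K L ρN) f g)) =
      H2π (absGaloisLayerRep K L ρZ)
        (mapCocycles₂ (A := absGaloisLayerRep K L ρM ⊗ absGaloisLayerRep K L ρN) (MonoidHom.id _) β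
          (cupOneOne (absGaloisLayerRep K L ρM) (absGaloisLayerRep K L ρN) f g)) :=
    H2π_comp_map_apply (A := absGaloisLayerRep K L ρM ⊗ absGaloisLayerRep K L ρN) (MonoidHom.id _) β _
  have h3 : infOneLayer K L ρM (H1π (absGaloisLayerRep K L ρM) f) =
      oneCocycleClass ρM.toTopRep (inflateOneCocycle K L ρM f) := infOneLayer_H1π K L ρM f
  have h4 : infOneLayer K L ρN (H1π (absGaloisLayerRep K L ρN) g) =
      oneCocycleClass ρN.toTopRep (inflateOneCocycle K L ρN g) := infOneLayer_H1π K L ρN g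
  have h5 : infTwo K L ρZ (H2π (absGaloisLayerRep K L ρZ)
        (mapCocycles₂ (A := absGaloisLayerRep K L ρM ⊗ absGaloisLayerRep K L ρN) (MonoidHom.id _) β
          (cupOneOne (absGaloisLayerRep K L ρM) (absGaloisLayerRep K L ρN) f g))) =
      twoCocycleClass ρZ.toTopRep (inflateTwoCocycle K L ρZ
        (mapCocycles₂ (A := absGaloisLayerRep K L ρM ⊗ absGaloisLayerRep K L ρN) (MonoidHom.id _) β
          (cupOneOne (absGaloisLayerRep K L ρM) (absGaloisLayerRep K L ρN) f g))) :=
    infTwo_H2π K L ρZ _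
  have h6 : φ.cupProduct (oneCocycleClass ρM.toTopRep (inflateOneCocycle K L ρM f))
        (oneCocycleClass ρN.toTopRep (inflateOneCocycle K L ρN g)) =
      twoCocycleClass ρZ.toTopRep (φ.cupCocycle (inflateOneCocycle K L ρM f) (inflateOneCocycle K L ρN g)) :=
    φ.cupProduct_oneCocycleClass_eq_twoCocycleClass _ _
  have e1 := (congrArg (map (A := absGaloisLayerRep K L ρM ⊗ absGaloisLayerRep K L ρN)
    (MonoidHom.id _) β 2) h1).trans h2
  have e2 := ((congrArg (infTwo K L ρZ) e1).trans h5).trans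
    (congrArg (twoCocycleClass ρZ.toTopRep)
      (inflateTwoCocycle_mapCocycles₂_cupOneOne K L ρM ρN ρZ φ β hβ f g))
  exact e2.trans ((congrArg₂ (fun a b => φ.cupProduct a b) h3 h4).trans h6).symm


/-- **`inf(x ∪_φ y) = inf x ∪_φ inf y`** with the canonical coefficient map `layerPairingHom φ`: the form
consumers use (no side hypothesis). [cite: NeukirchSchmidtWingberg2008, (1.5.3)]
[cite: SerreGaloisCohomology1997, I §2.6] -/
theorem infTwo_map_layerPairingHom_cupProductRep (φ : ContPairing ρM.toTopRep ρN.toTopRep ρZ.toTopRep)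
    (x : groupCohomology (absGaloisLayerRep K L ρM) 1) (y : groupCohomology (absGaloisLayerRep K L ρN) 1) :
    infTwo K L ρZ (map (A := absGaloisLayerRep K L ρM ⊗ absGaloisLayerRep K L ρN) (MonoidHom.id _)
        (layerPairingHom K L ρM ρN ρZ φ) 2
        (cupProductRep (absGaloisLayerRep K L ρM) (absGaloisLayerRep K L ρN) (rfl : 1 + 1 = 2) x y)) =
      φ.cupProduct (infOneLayer K L ρM x) (infOneLayer K L ρN y) :=
  infTwo_map_cupProductRep K L ρM ρN ρZ φ (layerPairingHom K L ρM ρN ρZ φ)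
    (layerPairingHom_tmul K L ρM ρN ρZ φ) x y

end Cup

end Literature.NumberTheory.GaloisRepresentations

end
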